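import Summits.AtomisticToContinuum.HydrodynamicLimit.Theses.JParityClosure
import Literature.MathematicalPhysics.KineticTheory.EvenCollisionTubeFunctional
import Literature.MathematicalPhysics.KineticTheory.MicroscaleWindowFunctionals
import Summits.AtomisticToContinuum.HydrodynamicLimit.Theorems.ImplosionDichotomyHydroLimitInBandEquilibrium
import HarnessLib

/-!
# The pre-shock frame at global equilibrium is the untied rung-0 frame
# (line `preshock-kinetic-slaving`, crux `JParityClosure.EvenStressEnskog`, stmt-AtomisticToContinuum-13079 — lead c7)

The recommended restatement R of the crux moves it (and its two children `ContactEvenPreShock`,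
`VelocityEquilibrationPreShock`) to the PRE-SHOCK, LLN-TIED frame of the sibling `OddContactSymmetry`: after `σ < σ₀`
one quantifies over a classical hs-Euler solution `(ρ,u,θ)` on `[0,T)`, over flow families whose local-Gibbs fields
satisfy the `t = 0` law of large numbers towards it, and over `0 < τ < T`.  This file proves that AT CONSTANT PROFILES
`(a, u, θ)` that frame costs nothing: the constant state `(1, u, θ)` is a GLOBAL classical solution
(`IsHardSphereEulerSolutionDim.const`, `isHardSphereEulerSolutionDim_three_iff`) and the homogeneous local Gibbs laws
DO satisfy the `t = 0` LLN towards it for every flow family (`PolynomialCompressionPDE.admissible_iff_data` with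
`HydroLimitInBandEquilibrium.rhoLim_constActivity_eq_one`), for all `σ` below a threshold depending on `(a,u,θ)` only.
Hence every pre-shock-framed statement, specialised to constant profiles, yields its untied rung-0 form
(`exists_forall_flow_of_preShockFrame_const`, generic in the concluded predicate), in particular:

* `velocityEquilibrationRung0_of_velocityEquilibrationPreShock` — the support child (L1) pre-shock ⇒ the registered
  rung-0 stub `stub_velocityEquilibrationRung0` of the line (its signature verbatim);
* `contactSideRung0_of_contactEvenPreShock` — the crux child pre-shock ⇒ the contact side at rung 0;
* `enskogSideRung0_of_enskogSidePreShock` — the Enskog side likewise.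

Together with `JParityClosureEvenStressEnskogRung0Sides` (rung-0 contact side ⇐ (L1)₀) this closes the bookkeeping
square at rung 0: R loses nothing at global equilibrium, and the rung 0 of both children is exactly what the
even-rung chain already controls.  Definition-free (bodies spelled out).  References: H. Spohn (1991) Part I §2.3,
§3.2; Chapman–Cowling (1970) Ch. 16.
-/

noncomputable section

namespace Summit.AtomisticToContinuum.HydrodynamicLimit.Theorems.EvenStressEnskog

open scoped BigOperators InnerProductSpace Topology ENNReal
open MeasureTheory Filter Set
open Literature.MathematicalPhysics.KineticTheory Literature.Analysis.FluidPDE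
open Literature.MathematicalPhysics.KineticTheory.StationaryMicroscale
open Summit.AtomisticToContinuum.HydrodynamicLimit.Theses.JParityClosure
open Summit.AtomisticToContinuum.HydrodynamicLimit.Theorems.PolynomialCompressionPDE
open Summit.AtomisticToContinuum.HydrodynamicLimit.Theorems.HydroLimitInBandEquilibrium

/-- **The pre-shock frame is free at constant profiles (generic form).**  If a predicate `Q σ Φ τ` of the reduced
density, the flow family and the horizon holds in the pre-shock, LLN-tied frame at the constant profiles `(a, u, θ)`
for all `σ < σ₀`, then for all `σ` below a (possibly smaller) positive threshold it holds for EVERY flow family and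
EVERY `τ > 0`: instantiate the frame with the constant classical solution `(1, u, θ)` on `[0, τ + 1)` and the `t = 0`
law of large numbers of the homogeneous local Gibbs laws towards it. [folklore] -/
theorem exists_forall_flow_of_preShockFrame_const {a θ : ℝ} {u : V3} (ha : 0 < a) (hθ : 0 < θ)
    {Q : (σ : ℝ) → ((N : ℕ) → HardSphereFlow (Torus.geometry (Fin 3)) (hsDiameter σ N) (N + 1)) → ℝ → Prop}
    {σ₀ : ℝ} (hσ₀ : 0 < σ₀)
    (H : ∀ σ : ℝ, 0 < σ → σ < σ₀ →
      ∀ (T : ℝ) (ρ θ' : ℝ → T3 → ℝ) (u' : ℝ → T3 → V3), IsHardSphereEulerSolution σ T ρ u' θ' →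
      ∀ Φ : (N : ℕ) → HardSphereFlow (Torus.geometry (Fin 3)) (hsDiameter σ N) (N + 1),
      TendstoHydroFieldsAt (fun N => localGibbsLaw σ (fun _ => a) (fun _ => u) (fun _ => θ) N (Φ N)) Φ ρ u' θ' 0 →
      ∀ τ : ℝ, 0 < τ → τ < T → Q σ Φ τ) :
    ∃ σ₁ : ℝ, 0 < σ₁ ∧ ∀ σ : ℝ, 0 < σ → σ < σ₁ →
      ∀ Φ : (N : ℕ) → HardSphereFlow (Torus.geometry (Fin 3)) (hsDiameter σ N) (N + 1),
      ∀ τ : ℝ, 0 < τ → Q σ Φ τ := by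
  obtain ⟨σ₂, hσ₂, -, A⟩ := admissible_iff_data (a₀ := fun _ : T3 => a) (θ₀ := fun _ => θ) (u₀ := fun _ => u)
    continuous_const continuous_const continuous_const (fun _ => ha) (fun _ => hθ)
  refine ⟨min σ₀ σ₂, lt_min hσ₀ hσ₂, fun σ hσ hσlt Φ τ hτ => ?_⟩
  have hσ0 : σ < σ₀ := lt_of_lt_of_le hσlt (min_le_left _ _)
  have hσ2 : σ < σ₂ := lt_of_lt_of_le hσlt (min_le_right _ _)
  obtain ⟨hsd, A'⟩ := A σ hσ hσ2
  -- the constant state `(1, u, θ)` is a global classical solution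
  have hconst : IsHardSphereEulerSolution σ (τ + 1) (fun _ _ => (1 : ℝ)) (fun _ _ => u) (fun _ _ => θ) :=
    isHardSphereEulerSolutionDim_three_iff.1 (IsHardSphereEulerSolutionDim.const σ (τ + 1) u one_pos hθ)
  -- the homogeneous local Gibbs laws satisfy the `t = 0` LLN towards it, for every flow family
  have hρ1 := rhoLim_constActivity_eq_one (σ := σ) ha hsd
  have hLLN : TendstoHydroFieldsAt (fun N => localGibbsLaw σ (fun _ => a) (fun _ => u) (fun _ => θ) N (Φ N)) Φ
      (fun _ _ => (1 : ℝ)) (fun _ _ => u) (fun _ _ => θ) 0 :=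
    (A' (fun _ _ => (1 : ℝ)) (fun _ _ => θ) (fun _ _ => u) continuous_const continuous_const continuous_const).2
      ⟨hρ1.symm, rfl, rfl⟩ Φ
  exact H σ hσ hσ0 (τ + 1) _ _ _ hconst Φ hLLN τ hτ (by linarith)

/-- **(L1) PRE-SHOCK ⇒ (L1)₀.**  The support child `VelocityEquilibrationPreShock` of the recommended split (body spelled
out: one-body `r`-scale statistic ≈ local-Maxwellian prediction, pre-shock LLN-tied frame), specialised to constant
profiles, gives VERBATIM the registered rung-0 stub `stub_velocityEquilibrationRung0` of the line (untied: every flow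
family, every `τ > 0`). [folklore] -/
theorem velocityEquilibrationRung0_of_velocityEquilibrationPreShock :
    (∃ η₀ : ℝ, 0 < η₀ ∧ ∀ (a₀ θ₀ : T3 → ℝ) (u₀ : T3 → V3), Continuous a₀ → Continuous θ₀ → Continuous u₀ →
      (∀ x, 0 < a₀ x) → (∀ x, 0 < θ₀ x) → ∃ σ₀ : ℝ, 0 < σ₀ ∧ ∀ σ : ℝ, 0 < σ → σ < σ₀ →
      ∀ (T : ℝ) (ρ θ : ℝ → T3 → ℝ) (u : ℝ → T3 → V3), IsHardSphereEulerSolution σ T ρ u θ →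
      ∀ Φ : (N : ℕ) → HardSphereFlow (Torus.geometry (Fin 3)) (hsDiameter σ N) (N + 1),
      TendstoHydroFieldsAt (fun N => localGibbsLaw σ a₀ u₀ θ₀ N (Φ N)) Φ ρ u θ 0 →
      ∀ τ : ℝ, 0 < τ → τ < T →
      ∀ χ : ℝ × T3 → ℝ, Continuous χ → ∀ k : ℝ → ℝ, Continuous k → (∀ a, η₀ ≤ a → k a = 0) →
      ∀ F : V3 × V3 × ℝ → ℝ, Continuous F →
      (∃ C : ℝ, ∀ q, |F q| ≤ C * (1 + ‖q.1‖ ^ 2 + ‖q.2.1‖ ^ 2 + |q.2.2|)) →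
      ∀ η δ : ℝ, 0 < η → 0 < δ → ∃ r₀ : ℝ, 0 < r₀ ∧ ∀ r : ℝ, 0 < r → r < r₀ → ∃ N₀ : ℕ, ∀ N : ℕ, N₀ ≤ N →
        localGibbsLaw σ a₀ u₀ θ₀ N (Φ N)
          {z | η < |oneBodyStat σ N (Φ N) τ χ k F r z - oneBodyPred σ N (Φ N) τ χ k F r z|}
          ≤ ENNReal.ofReal δ) →
    ∃ η₀ : ℝ, 0 < η₀ ∧ ∀ (a θ : ℝ) (u : V3), 0 < a → 0 < θ → ∃ σ₀ : ℝ, 0 < σ₀ ∧ ∀ σ : ℝ, 0 < σ → σ < σ₀ →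
      ∀ Φ : (N : ℕ) → HardSphereFlow (Torus.geometry (Fin 3)) (hsDiameter σ N) (N + 1),
      ∀ τ : ℝ, 0 < τ →
      ∀ χ : ℝ × T3 → ℝ, Continuous χ → ∀ k : ℝ → ℝ, Continuous k → (∀ b, η₀ ≤ b → k b = 0) →
      ∀ F : V3 × V3 × ℝ → ℝ, Continuous F →
      (∃ C : ℝ, ∀ q, |F q| ≤ C * (1 + ‖q.1‖ ^ 2 + ‖q.2.1‖ ^ 2 + |q.2.2|)) →
      ∀ η δ : ℝ, 0 < η → 0 < δ → ∃ r₀ : ℝ, 0 < r₀ ∧ ∀ r : ℝ, 0 < r → r < r₀ → ∃ N₀ : ℕ, ∀ N : ℕ, N₀ ≤ N →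
        localGibbsLaw σ (fun _ => a) (fun _ => u) (fun _ => θ) N (Φ N)
          {z | η < |oneBodyStat σ N (Φ N) τ χ k F r z - oneBodyPred σ N (Φ N) τ χ k F r z|}
          ≤ ENNReal.ofReal δ := by
  intro h
  obtain ⟨η₀, hη₀, H⟩ := h
  refine ⟨η₀, hη₀, fun a θ u ha hθ => ?_⟩
  obtain ⟨σ₀, hσ₀, H1⟩ := H (fun _ => a) (fun _ => θ) (fun _ => u) continuous_const continuous_const
    continuous_const (fun _ => ha) (fun _ => hθ)
  exact exists_forall_flow_of_preShockFrame_const ha hθ hσ₀ H1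

/-- **CONTACT SIDE PRE-SHOCK ⇒ CONTACT SIDE AT RUNG 0.**  The crux child `ContactEvenPreShock` of the recommended split
(body spelled out: `collisionSum ≈ contactPredM` for the six even marks, pre-shock LLN-tied frame), specialised to
constant profiles, gives the untied contact side at rung 0 (every flow family, every `τ > 0`). [folklore] -/
theorem contactSideRung0_of_contactEvenPreShock :
    (∃ η₀ : ℝ, 0 < η₀ ∧ ∀ (a₀ θ₀ : T3 → ℝ) (u₀ : T3 → V3), Continuous a₀ → Continuous θ₀ → Continuous u₀ →
      (∀ x, 0 < a₀ x) → (∀ x, 0 < θ₀ x) → ∃ σ₀ : ℝ, 0 < σ₀ ∧ ∀ σ : ℝ, 0 < σ → σ < σ₀ →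
      ∀ (T : ℝ) (ρ θ : ℝ → T3 → ℝ) (u : ℝ → T3 → V3), IsHardSphereEulerSolution σ T ρ u θ →
      ∀ Φ : (N : ℕ) → HardSphereFlow (Torus.geometry (Fin 3)) (hsDiameter σ N) (N + 1),
      TendstoHydroFieldsAt (fun N => localGibbsLaw σ a₀ u₀ θ₀ N (Φ N)) Φ ρ u θ 0 →
      ∀ τ : ℝ, 0 < τ → τ < T →
      ∀ χ : ℝ × T3 → ℝ, Continuous χ → ∀ g : ℝ → ℝ, Continuous g → (∀ a, η₀ ≤ a → g a = 0) →
      ∀ k l : Fin 3,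
      ∀ η δ : ℝ, 0 < η → 0 < δ → ∃ r₀ : ℝ, 0 < r₀ ∧ ∀ r : ℝ, 0 < r → r < r₀ → ∃ N₀ : ℕ, ∀ N : ℕ, N₀ ≤ N →
        localGibbsLaw σ a₀ u₀ θ₀ N (Φ N)
          {z | η < |collisionSum σ N (Φ N) τ χ g (evenMark k l) r z - contactPredM σ N (Φ N) τ χ g (evenMark k l) r z|}
          ≤ ENNReal.ofReal δ) →
    ∃ η₀ : ℝ, 0 < η₀ ∧ ∀ (a θ : ℝ) (u : V3), 0 < a → 0 < θ → ∃ σ₀ : ℝ, 0 < σ₀ ∧ ∀ σ : ℝ, 0 < σ → σ < σ₀ →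
      ∀ Φ : (N : ℕ) → HardSphereFlow (Torus.geometry (Fin 3)) (hsDiameter σ N) (N + 1), ∀ τ : ℝ, 0 < τ →
      ∀ χ : ℝ × T3 → ℝ, Continuous χ → ∀ g : ℝ → ℝ, Continuous g → (∀ a, η₀ ≤ a → g a = 0) →
      ∀ k l : Fin 3,
      ∀ η δ : ℝ, 0 < η → 0 < δ → ∃ r₀ : ℝ, 0 < r₀ ∧ ∀ r : ℝ, 0 < r → r < r₀ → ∃ N₀ : ℕ, ∀ N : ℕ, N₀ ≤ N →
        localGibbsLaw σ (fun _ => a) (fun _ => u) (fun _ => θ) N (Φ N)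
          {z | η < |collisionSum σ N (Φ N) τ χ g (evenMark k l) r z - contactPredM σ N (Φ N) τ χ g (evenMark k l) r z|}
          ≤ ENNReal.ofReal δ := by
  intro h
  obtain ⟨η₀, hη₀, H⟩ := h
  refine ⟨η₀, hη₀, fun a θ u ha hθ => ?_⟩
  obtain ⟨σ₀, hσ₀, H1⟩ := H (fun _ => a) (fun _ => θ) (fun _ => u) continuous_const continuous_const
    continuous_const (fun _ => ha) (fun _ => hθ)
  exact exists_forall_flow_of_preShockFrame_const ha hθ hσ₀ H1

/-- **ENSKOG SIDE PRE-SHOCK ⇒ ENSKOG SIDE AT RUNG 0** (same mechanism; `contactPredM ≈ σ³∫₀^τ enskogRate`). [folklore] -/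
theorem enskogSideRung0_of_enskogSidePreShock :
    (∃ η₀ : ℝ, 0 < η₀ ∧ ∀ (a₀ θ₀ : T3 → ℝ) (u₀ : T3 → V3), Continuous a₀ → Continuous θ₀ → Continuous u₀ →
      (∀ x, 0 < a₀ x) → (∀ x, 0 < θ₀ x) → ∃ σ₀ : ℝ, 0 < σ₀ ∧ ∀ σ : ℝ, 0 < σ → σ < σ₀ →
      ∀ (T : ℝ) (ρ θ : ℝ → T3 → ℝ) (u : ℝ → T3 → V3), IsHardSphereEulerSolution σ T ρ u θ →
      ∀ Φ : (N : ℕ) → HardSphereFlow (Torus.geometry (Fin 3)) (hsDiameter σ N) (N + 1),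
      TendstoHydroFieldsAt (fun N => localGibbsLaw σ a₀ u₀ θ₀ N (Φ N)) Φ ρ u θ 0 →
      ∀ τ : ℝ, 0 < τ → τ < T →
      ∀ χ : ℝ × T3 → ℝ, Continuous χ → ∀ g : ℝ → ℝ, Continuous g → (∀ a, η₀ ≤ a → g a = 0) →
      ∀ k l : Fin 3,
      ∀ η δ : ℝ, 0 < η → 0 < δ → ∃ r₀ : ℝ, 0 < r₀ ∧ ∀ r : ℝ, 0 < r → r < r₀ → ∃ N₀ : ℕ, ∀ N : ℕ, N₀ ≤ N →
        localGibbsLaw σ a₀ u₀ θ₀ N (Φ N)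
          {z | η < |contactPredM σ N (Φ N) τ χ g (evenMark k l) r z
                - σ ^ 3 * ∫ s in Set.Icc (0 : ℝ) τ, enskogRate σ N χ g (evenMark k l) r s ((Φ N).flow s z)|}
          ≤ ENNReal.ofReal δ) →
    ∃ η₀ : ℝ, 0 < η₀ ∧ ∀ (a θ : ℝ) (u : V3), 0 < a → 0 < θ → ∃ σ₀ : ℝ, 0 < σ₀ ∧ ∀ σ : ℝ, 0 < σ → σ < σ₀ →
      ∀ Φ : (N : ℕ) → HardSphereFlow (Torus.geometry (Fin 3)) (hsDiameter σ N) (N + 1), ∀ τ : ℝ, 0 < τ →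
      ∀ χ : ℝ × T3 → ℝ, Continuous χ → ∀ g : ℝ → ℝ, Continuous g → (∀ a, η₀ ≤ a → g a = 0) →
      ∀ k l : Fin 3,
      ∀ η δ : ℝ, 0 < η → 0 < δ → ∃ r₀ : ℝ, 0 < r₀ ∧ ∀ r : ℝ, 0 < r → r < r₀ → ∃ N₀ : ℕ, ∀ N : ℕ, N₀ ≤ N →
        localGibbsLaw σ (fun _ => a) (fun _ => u) (fun _ => θ) N (Φ N)
          {z | η < |contactPredM σ N (Φ N) τ χ g (evenMark k l) r z
                - σ ^ 3 * ∫ s in Set.Icc (0 : ℝ) τ, enskogRate σ N χ g (evenMark k l) r s ((Φ N).flow s z)|}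
          ≤ ENNReal.ofReal δ := by
  intro h
  obtain ⟨η₀, hη₀, H⟩ := h
  refine ⟨η₀, hη₀, fun a θ u ha hθ => ?_⟩
  obtain ⟨σ₀, hσ₀, H1⟩ := H (fun _ => a) (fun _ => θ) (fun _ => u) continuous_const continuous_const
    continuous_const (fun _ => ha) (fun _ => hθ)
  exact exists_forall_flow_of_preShockFrame_const ha hθ hσ₀ H1

end Summit.AtomisticToContinuum.HydrodynamicLimit.Theorems.EvenStressEnskog

end
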